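import Mathlib
import Literature.Geometry.Lorentzian.ReggeWheelerChannels
import Literature.Geometry.Lorentzian.ReggeWheelerTortoise
import Summits.FinalStateConjecture.FinalStateConjecture.Theorems.PhotonSphereChannelsUniformPhotonSphereChannelsNearKernelCensus
import Summits.FinalStateConjecture.FinalStateConjecture.Theorems.PhotonSphereChannelsTortoiseFar
import Summits.FinalStateConjecture.FinalStateConjecture.Theorems.PhotonSphereChannelsFarPotentialAsymptotics
import Summits.FinalStateConjecture.FinalStateConjecture.Theorems.PhotonSphereChannelsUniformPhotonSphereChannelsRPeelSeed

/-!
# Peeling, file 14: the far Regge–Wheeler potential and the recessive ladder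

Support file for `stub_peel` of the line `crum-peeling-recessive-tower` (crux
`UniformPhotonSphereChannelsR`, stmt-FinalStateConjecture-14074).

* `tendsto_radius_div` : `r(x)/x → 1` on the far side (`Theorems.tortoise_far_asymptotics`);
  `tendsto_sq_mul_linePotential` : `x² V_{s,ℓ}(r(x)) → ℓ(ℓ+1)`; `linePotential_zero_le` :
  `V_{0,0} ≤ 16M/x³` far out.
* The ladder `W_k' = U_k − W_k²`, `U_{k+1} = 2W_k² − U_k`, `x W_k → k − ℓ`, `U_0 = V` on `(a, ∞)`:
  `ladder_contDiffOn` — every `U_k`, `W_k` is smooth on `(a, ∞)`; `ladder_tendsto` —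
  `x² U_k → (ℓ−k)(ℓ−k+1)`; `ladder_thresholds` — one far threshold `X₁ ≥ 1`, `X₁ > a`, beyond which
  `x W_k ≤ −3/4`, `|x W_k| ≤ B`, `|x² U_k| ≤ C` for all rungs and `U_k ≥ 0` for `k < ℓ`.
-/

noncomputable section

-- the doubled `FinalStateConjecture` component is the tree's fixed summit/problem path
set_option linter.dupNamespace false

namespace Summit.FinalStateConjecture.FinalStateConjecture.Theorems.CrumPeelingRecessiveTower

open MeasureTheory Set Filter Topology
open Literature.Geometry.Lorentzian Literature.Geometry.Lorentzian.ReggeWheeler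
open scoped ContDiff

/-! ### The far potential -/

section Potential

variable {M : ℝ} {r : ℝ → ℝ} {xc : ℝ}

/-- **`r(x)/x → 1`** as `x → +∞` along a tortoise radius function. -/
theorem tendsto_radius_div (hr : IsTortoiseRadius M r xc) : Tendsto (fun x => r x / x) atTop (𝓝 1) := by
  have hM := hr.mass_pos
  -- `E(x) = (x − xc + 3M) − r x ∈ [0, 6M log(1 + (x − xc)/(9M))]`
  have hE : ∀ x, xc ≤ x → 0 ≤ (x - xc + 3 * M) - r x ∧
      (x - xc + 3 * M) - r x ≤ 6 * M * Real.log (1 + (x - xc) / (9 * M)) := fun x hx =>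
    tortoise_far_asymptotics hM hr.two_mul_lt hr.hasDerivAt hr.center hx
  -- `log(1 + ρ/(9M))/ρ → 0`, `ρ = x − xc`
  have hlog : Tendsto (fun x => Real.log (1 + (x - xc) / (9 * M)) / (x - xc)) atTop (𝓝 0) := by
    have h9 : 0 < 9 * M := by positivity
    have h := (tendsto_log_ratio_div h9).comp (tendsto_atTop_add_const_right atTop (-xc) tendsto_id)
    have hlow : Tendsto (fun _ : ℝ => (0 : ℝ)) atTop (𝓝 0) := tendsto_const_nhds
    refine tendsto_of_tendsto_of_tendsto_of_le_of_le' hlow h ?_ ?_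
    · filter_upwards [eventually_gt_atTop xc] with x hx
      have hρ : 0 < x - xc := sub_pos.2 hx
      exact div_nonneg (Real.log_nonneg (by have := div_nonneg hρ.le h9.le; linarith)) hρ.le
    · filter_upwards [eventually_gt_atTop xc] with x hx
      have hρ : 0 < x - xc := sub_pos.2 hx
      simp only [Function.comp, id]
      rw [show x + -xc = x - xc by ring]
      exact div_le_div_of_nonneg_right (by linarith) hρ.le
  -- `r x / x = 1 + (3M − xc)/x − (E x / (x − xc)) · ((x − xc)/x)`
  have h1 : Tendsto (fun x : ℝ => (3 * M - xc) / x) atTop (𝓝 0) := tendsto_const_nhds.div_atTop tendsto_id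
  have h2 : Tendsto (fun x : ℝ => (x - xc) / x) atTop (𝓝 1) := by
    have : Tendsto (fun x : ℝ => 1 - xc / x) atTop (𝓝 (1 - 0)) :=
      tendsto_const_nhds.sub (tendsto_const_nhds.div_atTop tendsto_id)
    rw [sub_zero] at this
    refine this.congr' ?_
    filter_upwards [eventually_gt_atTop 0] with x hx
    field_simp
  have hEdiv : Tendsto (fun x => ((x - xc + 3 * M) - r x) / (x - xc)) atTop (𝓝 0) := by
    have hup : Tendsto (fun x => 6 * M * (Real.log (1 + (x - xc) / (9 * M)) / (x - xc))) atTop (𝓝 0) := by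
      simpa using hlog.const_mul (6 * M)
    refine tendsto_of_tendsto_of_tendsto_of_le_of_le' tendsto_const_nhds hup ?_ ?_
    · filter_upwards [eventually_gt_atTop xc] with x hx
      exact div_nonneg (hE x hx.le).1 (sub_pos.2 hx).le
    · filter_upwards [eventually_gt_atTop xc] with x hx
      rw [mul_div_assoc']
      exact div_le_div_of_nonneg_right (hE x hx.le).2 (sub_pos.2 hx).le
  have hmain : Tendsto (fun x => 1 + (3 * M - xc) / x - ((x - xc + 3 * M) - r x) / (x - xc) * ((x - xc) / x))
      atTop (𝓝 (1 + 0 - 0 * 1)) := (tendsto_const_nhds.add h1).sub (hEdiv.mul h2)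
  rw [show (1 : ℝ) + 0 - 0 * 1 = 1 by norm_num] at hmain
  refine hmain.congr' ?_
  filter_upwards [eventually_gt_atTop xc, eventually_gt_atTop 0] with x hx hx0
  have hρ : x - xc ≠ 0 := (sub_pos.2 hx).ne'
  field_simp
  ring

/-- **Far limit of the rescaled potential**: `x² V_{s,ℓ}(r(x)) → ℓ(ℓ+1)`. -/
theorem tendsto_sq_mul_linePotential (hr : IsTortoiseRadius M r xc) (s ℓ : ℕ) :
    Tendsto (fun x => x ^ 2 * linePotential M s ℓ r x) atTop (𝓝 ((ℓ : ℝ) * ((ℓ : ℝ) + 1))) := by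
  have hM := hr.mass_pos
  have hr0 : ∀ x, 0 < r x := hr.pos
  have hrinf := hr.tendsto_atTop
  have hinv : Tendsto (fun x => (r x)⁻¹) atTop (𝓝 0) := hrinf.inv_tendsto_atTop
  have hq : Tendsto (fun x => x / r x) atTop (𝓝 1) := by
    have h := (tendsto_radius_div hr).inv₀ one_ne_zero
    rw [inv_one] at h
    refine h.congr' ?_
    filter_upwards [eventually_gt_atTop 0] with x hx
    rw [inv_div]
  set L : ℝ := (ℓ : ℝ) * ((ℓ : ℝ) + 1) with hL
  have hmain : Tendsto (fun x => (x / r x) ^ 2 * ((1 - 2 * M * (r x)⁻¹) *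
      (L + (1 - (s : ℝ) ^ 2) * (2 * M) * (r x)⁻¹))) atTop
      (𝓝 (1 ^ 2 * ((1 - 2 * M * 0) * (L + (1 - (s : ℝ) ^ 2) * (2 * M) * 0)))) :=
    (hq.pow 2).mul ((tendsto_const_nhds.sub (hinv.const_mul _)).mul
      (tendsto_const_nhds.add (hinv.const_mul _)))
  rw [show (1 : ℝ) ^ 2 * ((1 - 2 * M * 0) * (L + (1 - (s : ℝ) ^ 2) * (2 * M) * 0)) = L by ring] at hmain
  refine hmain.congr' ?_
  filter_upwards [eventually_gt_atTop 0] with x hx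
  have hrx := (hr0 x).ne'
  simp only [linePotential_apply, rwPotential, hL]
  field_simp

/-- The `ℓ = 0` (hence `s = 0`) potential is `O(x⁻³)`: `V_{0,0}(r(x)) ≤ 16M/x³` far out. -/
theorem linePotential_zero_le (hr : IsTortoiseRadius M r xc) :
    ∃ X₀ : ℝ, 1 ≤ X₀ ∧ ∀ x, X₀ ≤ x → linePotential M 0 0 r x ≤ 16 * M / x ^ 3 := by
  have hM := hr.mass_pos
  have hev : ∀ᶠ x in atTop, 1 / 2 < r x / x := (tendsto_radius_div hr).eventually_const_lt (by norm_num)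
  obtain ⟨N, hN⟩ := Filter.eventually_atTop.1 hev
  refine ⟨max N 1, le_max_right _ _, fun x hx => ?_⟩
  have hx1 : 1 ≤ x := le_trans (le_max_right _ _) hx
  have hx0 : 0 < x := by linarith
  have hrx : x / 2 ≤ r x := by
    have h := hN x (le_trans (le_max_left _ _) hx)
    rw [lt_div_iff₀ hx0] at h; linarith
  have hr0 : 0 < r x := hr.pos x
  have hfac : 1 - 2 * M / r x ≤ 1 := by
    have : 0 ≤ 2 * M / r x := div_nonneg (by linarith) hr0.le; linarith
  have hfac0 : 0 ≤ 1 - 2 * M / r x := (hr.deriv_pos x).le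
  simp only [linePotential_apply, rwPotential_zero]
  have hterm0 : 0 ≤ 2 * M / r x ^ 3 := by positivity
  calc (1 - 2 * M / r x) * ((0 : ℕ) * (((0 : ℕ) : ℝ) + 1) / r x ^ 2 + 2 * M / r x ^ 3)
      = (1 - 2 * M / r x) * (2 * M / r x ^ 3) := by push_cast; ring
    _ ≤ 1 * (2 * M / r x ^ 3) := mul_le_mul_of_nonneg_right hfac hterm0
    _ = 2 * M / r x ^ 3 := one_mul _
    _ ≤ 2 * M / (x / 2) ^ 3 := by
        apply div_le_div_of_nonneg_left (by linarith) (by positivity)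
        exact pow_le_pow_left₀ (by linarith) hrx 3
    _ = 16 * M / x ^ 3 := by field_simp; ring

end Potential

/-! ### The ladder -/

section Ladder

variable {a : ℝ} {ℓ : ℕ} {W U : ℕ → ℝ → ℝ}

/-- **Smoothness of the ladder**: if `U 0` is smooth on `(a, ∞)`, `W_k' = U_k − W_k²` and
`U_{k+1} = 2W_k² − U_k` there (`k < ℓ`), then every `U k` (`k ≤ ℓ`) and every `W k` (`k < ℓ`) is
smooth on `(a, ∞)`. -/
theorem ladder_contDiffOn (hU0 : ContDiffOn ℝ ∞ (U 0) (Ioi a))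
    (hWd : ∀ k, k < ℓ → ∀ x, a < x → HasDerivAt (W k) (U k x - W k x ^ 2) x)
    (hUs : ∀ k, k < ℓ → ∀ x, a < x → U (k + 1) x = 2 * W k x ^ 2 - U k x) :
    (∀ k, k ≤ ℓ → ContDiffOn ℝ ∞ (U k) (Ioi a)) ∧ (∀ k, k < ℓ → ContDiffOn ℝ ∞ (W k) (Ioi a)) := by
  have hWof : ∀ k, k < ℓ → ContDiffOn ℝ ∞ (U k) (Ioi a) → ContDiffOn ℝ ∞ (W k) (Ioi a) := by
    intro k hk hUk
    refine contDiffOn_infty_of_deriv_eq (F := fun x y => U k x - y ^ 2) isOpen_Ioi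
      (fun x hx => (hWd k hk x hx).differentiableAt.differentiableWithinAt) ?_
      fun x hx => (hWd k hk x hx).deriv
    exact (hUk.comp contDiffOn_fst fun p hp => (mem_prod.1 hp).1).sub (contDiffOn_snd.pow 2)
  have hUall : ∀ k, k ≤ ℓ → ContDiffOn ℝ ∞ (U k) (Ioi a) := by
    intro k
    induction k with
    | zero => exact fun _ => hU0
    | succ k ih =>
      intro hk
      have hk' : k < ℓ := Nat.lt_of_succ_le hk
      have hUk := ih hk'.le
      have hWk := hWof k hk' hUk
      exact ((contDiffOn_const.mul (hWk.pow 2)).sub hUk).congr fun x hx => hUs k hk' x hx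
  exact ⟨hUall, fun k hk => hWof k hk (hUall k hk.le)⟩

/-- **Far limits along the ladder**: `x² U_k(x) → (ℓ−k)(ℓ−k+1)` for `k ≤ ℓ`. -/
theorem ladder_tendsto (hV : Tendsto (fun x => x ^ 2 * U 0 x) atTop (𝓝 ((ℓ : ℝ) * ((ℓ : ℝ) + 1))))
    (hUs : ∀ k, k < ℓ → ∀ x, a < x → U (k + 1) x = 2 * W k x ^ 2 - U k x)
    (hlim : ∀ k, k < ℓ → Tendsto (fun x => x * W k x) atTop (𝓝 ((k : ℝ) - ℓ))) :
    ∀ k, k ≤ ℓ → Tendsto (fun x => x ^ 2 * U k x) atTop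
      (𝓝 (((ℓ : ℝ) - k) * (((ℓ : ℝ) - k) + 1))) := by
  intro k
  induction k with
  | zero => intro _; simpa using hV
  | succ k ih =>
    intro hk
    have hk' : k < ℓ := Nat.lt_of_succ_le hk
    have h := ((hlim k hk').pow 2).const_mul 2 |>.sub (ih hk'.le)
    have e : 2 * ((k : ℝ) - ℓ) ^ 2 - ((ℓ : ℝ) - k) * (((ℓ : ℝ) - k) + 1)
        = ((ℓ : ℝ) - (k + 1 : ℕ)) * (((ℓ : ℝ) - (k + 1 : ℕ)) + 1) := by push_cast; ring
    rw [e] at h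
    refine h.congr' ?_
    filter_upwards [eventually_gt_atTop a] with x hx
    rw [hUs k hk' x hx]; ring

/-- **One far threshold for the whole ladder.**  There are `X₁ > a`, `X₁ ≥ 1`, and constants
`B, C` with: `x W_k ≤ −3/4` and `|x W_k| ≤ B` for `k < ℓ`, `|x² U_k| ≤ C` for `k ≤ ℓ`, and
`0 ≤ U_k` for `k < ℓ`, all for `x ≥ X₁`. -/
theorem ladder_thresholds (hV : Tendsto (fun x => x ^ 2 * U 0 x) atTop (𝓝 ((ℓ : ℝ) * ((ℓ : ℝ) + 1))))
    (hUs : ∀ k, k < ℓ → ∀ x, a < x → U (k + 1) x = 2 * W k x ^ 2 - U k x)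
    (hlim : ∀ k, k < ℓ → Tendsto (fun x => x * W k x) atTop (𝓝 ((k : ℝ) - ℓ))) :
    ∃ X₁ B C : ℝ, a < X₁ ∧ 1 ≤ X₁ ∧
      (∀ k, k < ℓ → ∀ x, X₁ ≤ x → x * W k x ≤ -3 / 4 ∧ |x * W k x| ≤ B) ∧
      (∀ k, k ≤ ℓ → ∀ x, X₁ ≤ x → |x ^ 2 * U k x| ≤ C) ∧
      (∀ k, k < ℓ → ∀ x, X₁ ≤ x → 0 ≤ U k x) := by
  have hUlim := ladder_tendsto hV hUs hlim
  set B : ℝ := (ℓ : ℝ) + 1 with hB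
  set C : ℝ := ((ℓ : ℝ) + 1) ^ 2 + 1 with hC
  -- eventual statements, rung by rung
  have hW_ev : ∀ k ∈ Finset.range ℓ, ∀ᶠ x in atTop, x * W k x ≤ -3 / 4 ∧ |x * W k x| ≤ B := by
    intro k hk
    have hk' : k < ℓ := Finset.mem_range.1 hk
    have hkl : (k : ℝ) - ℓ ≤ -1 := by
      have : (k : ℝ) + 1 ≤ ℓ := by exact_mod_cast hk'
      linarith
    have h1 : ∀ᶠ x in atTop, x * W k x < -3 / 4 := (hlim k hk').eventually_lt_const (by linarith)
    have h2 : ∀ᶠ x in atTop, -((ℓ : ℝ) + 1) < x * W k x :=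
      (hlim k hk').eventually_const_lt (by have : (0 : ℝ) ≤ k := k.cast_nonneg; linarith)
    filter_upwards [h1, h2] with x hx1 hx2
    refine ⟨hx1.le, ?_⟩
    rw [abs_le]; constructor <;> linarith
  have hU_ev : ∀ k ∈ Finset.range (ℓ + 1), ∀ᶠ x in atTop, |x ^ 2 * U k x| ≤ C ∧ (k < ℓ → 0 ≤ x ^ 2 * U k x) := by
    intro k hk
    have hk' : k ≤ ℓ := Nat.lt_succ_iff.1 (Finset.mem_range.1 hk)
    set Lk : ℝ := ((ℓ : ℝ) - k) * (((ℓ : ℝ) - k) + 1) with hLk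
    have hkR : (k : ℝ) ≤ ℓ := by exact_mod_cast hk'
    have hLk0 : 0 ≤ (ℓ : ℝ) - k := by linarith
    have hLkC : Lk + 1 ≤ C := by
      simp only [hLk, hC]
      have : (ℓ : ℝ) - k ≤ ℓ := by have : (0 : ℝ) ≤ k := k.cast_nonneg; linarith
      nlinarith
    have h1 : ∀ᶠ x in atTop, x ^ 2 * U k x < Lk + 1 := (hUlim k hk').eventually_lt_const (by linarith)
    have h2 : ∀ᶠ x in atTop, Lk - 1 < x ^ 2 * U k x := (hUlim k hk').eventually_const_lt (by linarith)
    have h3 : k < ℓ → ∀ᶠ x in atTop, Lk / 2 < x ^ 2 * U k x := fun hkl =>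
      (hUlim k hk').eventually_const_lt (by
        have : (1 : ℝ) ≤ (ℓ : ℝ) - k := by
          have : (k : ℝ) + 1 ≤ ℓ := by exact_mod_cast hkl
          linarith
        have : (2 : ℝ) ≤ Lk := by simp only [hLk]; nlinarith
        linarith)
    by_cases hkl : k < ℓ
    · filter_upwards [h1, h2, h3 hkl] with x hx1 hx2 hx3
      have hLk2 : 0 ≤ Lk := by simp only [hLk]; positivity
      refine ⟨?_, fun _ => by linarith⟩
      rw [abs_le]; constructor <;> nlinarith
    · filter_upwards [h1, h2] with x hx1 hx2
      have hLk2 : 0 ≤ Lk := by simp only [hLk]; positivity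
      refine ⟨?_, fun h => absurd h hkl⟩
      rw [abs_le]; constructor <;> nlinarith
  have hall := ((Finset.range ℓ).eventually_all.2 hW_ev).and
    (((Finset.range (ℓ + 1)).eventually_all.2 hU_ev).and (eventually_gt_atTop (0 : ℝ)))
  obtain ⟨N, hN⟩ := Filter.eventually_atTop.1 hall
  refine ⟨max N (max (a + 1) 1), B, C, ?_, le_trans (le_max_right _ _) (le_max_right _ _),
    fun k hk x hx => ?_, fun k hk x hx => ?_, fun k hk x hx => ?_⟩
  · have : a + 1 ≤ max N (max (a + 1) 1) := le_trans (le_max_left _ _) (le_max_right _ _); linarith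
  · exact (hN x (le_trans (le_max_left _ _) hx)).1 k (Finset.mem_range.2 hk)
  · exact ((hN x (le_trans (le_max_left _ _) hx)).2.1 k (Finset.mem_range.2 (Nat.lt_succ_of_le hk))).1
  · have h := hN x (le_trans (le_max_left _ _) hx)
    have hx0 : 0 < x := h.2.2
    have h2 := (h.2.1 k (Finset.mem_range.2 (Nat.lt_succ_of_lt hk))).2 hk
    exact nonneg_of_mul_nonneg_right (by rwa [mul_comm] at h2) (by positivity)

end Ladder

/-- Registered sub-goal `peel_radiusDiv` of `stub_peel` (verbatim signature): `r(x)/x → 1` along a tortoise radius function. -/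
theorem peel_radiusDiv : ∀ (M : ℝ) (r : ℝ → ℝ) (xc : ℝ), Literature.Geometry.Lorentzian.ReggeWheeler.IsTortoiseRadius M r xc → Filter.Tendsto (fun x => r x / x) Filter.atTop (nhds 1) :=
  fun _ _ _ hr => tendsto_radius_div hr

end Summit.FinalStateConjecture.FinalStateConjecture.Theorems.CrumPeelingRecessiveTower
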